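/-
COR-CM (cell pub-hodgecm2, stage 2 of the Hodge ladder) — count-neutral KERNEL COMBINATORICS «the named composite cyclotomic fields»
(seat prover-pub-hodgecm2-b23-g39-0, binder prover b23, gen 39; claim ABELIAN-DATUM D3, HOME/INBOX.md l.9432; blanket `CorCM/FaceCyclotomic*`).
Theorems only: the datum-free cyclotomic packaging of `CorCM/FaceAbelianSlices.lean` (D2) with this seat's gen-37 numeric instances
(`Census/EvenSliceFaceTransportCounts.lean`) BY NAME; the unit tables are checked by `decide`; no geometry, no named fact, nothing asserted;
`Interfaces.lean` (C1), every E term, B01 and `Transposition/*` are untouched.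
HONEST FRAMING (COORDINATOR RULING — HODGE FRAMING CORRECTION, 2026-08-21T11:55:35Z): `HC_CM` is NOT proved, here or anywhere in the
tree; every `HodgeConjectureFor` below is CONDITIONAL on face periods; no period is produced.
T5: n/a-class — the only Prop hypothesis binder displayed is INT2-GEN's period hypothesis on the produced face set; checker: self
(prover-pub-hodgecm2-b23-g39-0), 2026-08-22.
-/
import Summits.HodgeConjecture.CorCM.FaceAbelianSlices
import Summits.HodgeConjecture.CorCM.Census.EvenSliceFaceTransportCounts
import HarnessLib

/-!
# The named composite cyclotomic CM fields `ℚ(ζ₁₅), ℚ(ζ₁₆), ℚ(ζ₂₀), ℚ(ζ₂₁), ℚ(ζ₂₄), ℚ(ζ₂₈)`: datum-free face sets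

Gen 37's numeric instances (`exists_faceSet_evenSlice_zmod_four` / `_zmod_six` / `_zmod_two_sq`: at most `2` / `6` / `3` faces for an
`Aut`-datum onto `ℤ/2 × ℤ/4`, `ℤ/2 × ℤ/6`, `ℤ/2 × (ℤ/2)²`) named these fields in their docstrings but REQUIRED the datum as input.  Here the
datum is produced in the kernel (D1 `FaceAbelian.autEquivPow_conjAut`: complex conjugation `= −1 ∈ (ℤ/N)ˣ`; D1
`exists_addChar_of_not_isSquare`: `−1 ∉ ((ℤ/N)ˣ)²` gives the detecting character; D2 `exists_autDatum_cyclotomic_of_unitTable`) from a unit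
table `(ℤ/N)ˣ → A` presenting `(ℤ/N)ˣ/±1` (cosets `g^k·{±1} ↦ k`), each of whose four properties is a `decide`, so the theorems below have
NO hypothesis beyond `[IsCyclotomicExtension {N} ℚ K]`:

| `N` | `[K:ℚ]` | why `−1 ∉ ((ℤ/N)ˣ)²` | `A = Aut(K)/⟨c⟩ ≅ Gal(K⁺/ℚ)` | `#OrbitsA A` | faces |
|---|---|---|---|---|---|
| 15 | 8 | `3 ≡ 3 (4)` divides | `ℤ/4` (`⟨2⟩`) | 3 | ≤ 2 |
| 16 | 8 | `4 ∣ N` | `ℤ/4` (`⟨3⟩`) | 3 | ≤ 2 |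
| 20 | 8 | `4 ∣ N` | `ℤ/4` (`⟨3⟩`) | 3 | ≤ 2 |
| 24 | 8 | `4 ∣ N` | `(ℤ/2)²` | 4 | ≤ 3 |
| 21 | 12 | `3, 7 ≡ 3 (4)` divide | `ℤ/6` (`⟨2⟩`) | 7 | ≤ 6 |
| 28 | 12 | `4 ∣ N` | `ℤ/6` (`⟨5⟩`) | 7 | ≤ 6 |

Each `exists_faceSet_cyclotomic_<N>`: for `K` ANY CM field that is an `N`-th cyclotomic extension of `ℚ` and any complex embedding `σ₀`,
a face set `𝒮` of `K` of at most the stated size EXISTS such that ONE period witness per face of `𝒮` on the universe of record implies the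
Hodge conjecture, in every codimension, for every complex abelian variety dominated by a finite product of abelian varieties realising CM
types of CM fields embeddable in `K` — CONDITIONAL; `HC_CM` is NOT proved, no period is produced.  (By seat b09's parity floor the sizes
are least possible; that sentence is prose here, not restated.)

References: [cite: Washington1997, Thm. 2.5]; [cite: Pohlmann1968, Thm. 1]; [cite: Milne1999LefschetzClasses, Thm. 3.2 and Cor. 4.5];
[cite: Shimura1998, §6.2 Theorem 3 and §6.1 Corollary of Theorem 2 (pp. 41–43)]; [cite: MumfordAV1970, §19 Thm. 1 and p. 169].
-/

noncomputable section

open CategoryTheory NumberField NumberField.ComplexEmbedding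
open Literature.AlgebraicGeometry Literature.AlgebraicGeometry.Motives Literature.AlgebraicGeometry.HodgeTheory
open Literature.AlgebraicGeometry.ComplexMultiplication Literature.AlgebraicGeometry.Milne1999
open Literature.NumberTheory.Automorphic
open Literature.NumberTheory.Automorphic.PicardCM
open Summit.HodgeConjecture.CorCM.Domination

namespace Summit.HodgeConjecture.CorCM.FaceAbelian

/-- **`ℚ(ζ₁₅)` (degree `8`, `Aut ≅ (ℤ/15)ˣ`, `A ≅ ℤ/4`, `3` orbits): at most `2` faces** whose periods give HC of the slice — no
datum hypothesis (`3 ∣ 15`, `3 ≡ 3 (mod 4)`; unit table = cosets `2^k·{±1} ↦ k`).  CONDITIONAL; `HC_CM` is NOT proved.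
[cite: Washington1997, Thm. 2.5] [cite: Shimura1998, §6.2 Theorem 3 and §6.1 Corollary of Theorem 2 (pp. 41–43)]
[cite: Pohlmann1968, Thm. 1] [cite: Milne1999LefschetzClasses, Thm. 3.2 and Cor. 4.5] [cite: MumfordAV1970, §19 Thm. 1 and p. 169] -/
theorem exists_faceSet_cyclotomic_fifteen (K : CMField) [IsCyclotomicExtension {15} ℚ (K : Type)] (σ₀ : (K : Type) →+* ℂ) :
    ∃ 𝒮 : Finset (Face K), 𝒮.card ≤ 2 ∧
      ((∀ f ∈ 𝒮, ∃ ι₁ : K →+* ℂ, f.Admissible ι₁ ∧ ∃ (V : HermSpace3 K ι₁) (σ : K →+* ℂ),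
        (Model.picardCMUniverse exists_isReal_hodgeModel_holds hodgePQ_independent_of_hodgeModel_holds
          BallQuotient.ballQuotientUniformised_holds cmAbelianVarietyRealised_holds).PeriodNV ι₁ V K f.psi σ) →
      ∀ {P B : AbelianVariety ℂ}, AbelianVariety.IsProductOf (fun B : AbelianVariety ℂ =>
        ∃ (E : Type) (_ : Field E) (_ : NumberField E) (_ : IsCMField E) (_ : E →+* (K : Type)) (Φ : CMType E)
          (ι : 𝓞 E →+* End B) (θ : E →+* Module.End ℂ (complexBetti B.X 1)),
          IsCMTypeRealisation Φ B ι θ) P →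
      AVDominatedBy B P → HodgeConjectureFor B.dim B.X) := by
  haveI : IsGalois ℚ (K : Type) := IsCyclotomicExtension.isGalois {15} ℚ (K : Type)
  obtain ⟨c, ε, hcσ, hε, hεc⟩ := exists_autDatum_cyclotomic_of_unitTable (K : Type) (N := 15) (A := ZMod 4) (by decide)
    (fun u : (ZMod 15)ˣ =>
      if (u : ZMod 15).val = 1 ∨ (u : ZMod 15).val = 14 then (0 : ZMod 4) else
      if (u : ZMod 15).val = 2 ∨ (u : ZMod 15).val = 13 then (1 : ZMod 4) else
      if (u : ZMod 15).val = 4 ∨ (u : ZMod 15).val = 11 then (2 : ZMod 4) else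
      (3 : ZMod 4))
    (by decide) (by decide) (by decide) (by decide) σ₀
  exact exists_faceSet_evenSlice_zmod_four K σ₀ ε hε hcσ hεc

/-- **`ℚ(ζ₁₆)` (degree `8`, `Aut ≅ (ℤ/16)ˣ`, `A ≅ ℤ/4`, `3` orbits): at most `2` faces** whose periods give HC of the slice — no
datum hypothesis (`4 ∣ 16`; unit table = cosets `3^k·{±1} ↦ k`).  CONDITIONAL; `HC_CM` is NOT proved.
[cite: Washington1997, Thm. 2.5] [cite: Shimura1998, §6.2 Theorem 3 and §6.1 Corollary of Theorem 2 (pp. 41–43)]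
[cite: Pohlmann1968, Thm. 1] [cite: Milne1999LefschetzClasses, Thm. 3.2 and Cor. 4.5] [cite: MumfordAV1970, §19 Thm. 1 and p. 169] -/
theorem exists_faceSet_cyclotomic_sixteen (K : CMField) [IsCyclotomicExtension {16} ℚ (K : Type)] (σ₀ : (K : Type) →+* ℂ) :
    ∃ 𝒮 : Finset (Face K), 𝒮.card ≤ 2 ∧
      ((∀ f ∈ 𝒮, ∃ ι₁ : K →+* ℂ, f.Admissible ι₁ ∧ ∃ (V : HermSpace3 K ι₁) (σ : K →+* ℂ),
        (Model.picardCMUniverse exists_isReal_hodgeModel_holds hodgePQ_independent_of_hodgeModel_holds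
          BallQuotient.ballQuotientUniformised_holds cmAbelianVarietyRealised_holds).PeriodNV ι₁ V K f.psi σ) →
      ∀ {P B : AbelianVariety ℂ}, AbelianVariety.IsProductOf (fun B : AbelianVariety ℂ =>
        ∃ (E : Type) (_ : Field E) (_ : NumberField E) (_ : IsCMField E) (_ : E →+* (K : Type)) (Φ : CMType E)
          (ι : 𝓞 E →+* End B) (θ : E →+* Module.End ℂ (complexBetti B.X 1)),
          IsCMTypeRealisation Φ B ι θ) P →
      AVDominatedBy B P → HodgeConjectureFor B.dim B.X) := by
  haveI : IsGalois ℚ (K : Type) := IsCyclotomicExtension.isGalois {16} ℚ (K : Type)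
  obtain ⟨c, ε, hcσ, hε, hεc⟩ := exists_autDatum_cyclotomic_of_unitTable (K : Type) (N := 16) (A := ZMod 4) (by decide)
    (fun u : (ZMod 16)ˣ =>
      if (u : ZMod 16).val = 1 ∨ (u : ZMod 16).val = 15 then (0 : ZMod 4) else
      if (u : ZMod 16).val = 3 ∨ (u : ZMod 16).val = 13 then (1 : ZMod 4) else
      if (u : ZMod 16).val = 9 ∨ (u : ZMod 16).val = 7 then (2 : ZMod 4) else
      (3 : ZMod 4))
    (by decide) (by decide) (by decide) (by decide) σ₀
  exact exists_faceSet_evenSlice_zmod_four K σ₀ ε hε hcσ hεc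

/-- **`ℚ(ζ₂₀)` (degree `8`, `Aut ≅ (ℤ/20)ˣ`, `A ≅ ℤ/4`, `3` orbits): at most `2` faces** whose periods give HC of the slice — no
datum hypothesis (`4 ∣ 20`; unit table = cosets `3^k·{±1} ↦ k`).  CONDITIONAL; `HC_CM` is NOT proved.
[cite: Washington1997, Thm. 2.5] [cite: Shimura1998, §6.2 Theorem 3 and §6.1 Corollary of Theorem 2 (pp. 41–43)]
[cite: Pohlmann1968, Thm. 1] [cite: Milne1999LefschetzClasses, Thm. 3.2 and Cor. 4.5] [cite: MumfordAV1970, §19 Thm. 1 and p. 169] -/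
theorem exists_faceSet_cyclotomic_twenty (K : CMField) [IsCyclotomicExtension {20} ℚ (K : Type)] (σ₀ : (K : Type) →+* ℂ) :
    ∃ 𝒮 : Finset (Face K), 𝒮.card ≤ 2 ∧
      ((∀ f ∈ 𝒮, ∃ ι₁ : K →+* ℂ, f.Admissible ι₁ ∧ ∃ (V : HermSpace3 K ι₁) (σ : K →+* ℂ),
        (Model.picardCMUniverse exists_isReal_hodgeModel_holds hodgePQ_independent_of_hodgeModel_holds
          BallQuotient.ballQuotientUniformised_holds cmAbelianVarietyRealised_holds).PeriodNV ι₁ V K f.psi σ) →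
      ∀ {P B : AbelianVariety ℂ}, AbelianVariety.IsProductOf (fun B : AbelianVariety ℂ =>
        ∃ (E : Type) (_ : Field E) (_ : NumberField E) (_ : IsCMField E) (_ : E →+* (K : Type)) (Φ : CMType E)
          (ι : 𝓞 E →+* End B) (θ : E →+* Module.End ℂ (complexBetti B.X 1)),
          IsCMTypeRealisation Φ B ι θ) P →
      AVDominatedBy B P → HodgeConjectureFor B.dim B.X) := by
  haveI : IsGalois ℚ (K : Type) := IsCyclotomicExtension.isGalois {20} ℚ (K : Type)
  obtain ⟨c, ε, hcσ, hε, hεc⟩ := exists_autDatum_cyclotomic_of_unitTable (K : Type) (N := 20) (A := ZMod 4) (by decide)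
    (fun u : (ZMod 20)ˣ =>
      if (u : ZMod 20).val = 1 ∨ (u : ZMod 20).val = 19 then (0 : ZMod 4) else
      if (u : ZMod 20).val = 3 ∨ (u : ZMod 20).val = 17 then (1 : ZMod 4) else
      if (u : ZMod 20).val = 9 ∨ (u : ZMod 20).val = 11 then (2 : ZMod 4) else
      (3 : ZMod 4))
    (by decide) (by decide) (by decide) (by decide) σ₀
  exact exists_faceSet_evenSlice_zmod_four K σ₀ ε hε hcσ hεc

/-- **`ℚ(ζ₂₄)` (degree `8`, `Aut ≅ (ℤ/24)ˣ`, `A ≅ (ℤ/2)²`, `4` orbits): at most `3` faces** whose periods give HC of the slice — no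
datum hypothesis (`4 ∣ 24`; unit table = the four cosets of `±1` ↦ `(ℤ/2)²`).  CONDITIONAL; `HC_CM` is NOT proved.
[cite: Washington1997, Thm. 2.5] [cite: Shimura1998, §6.2 Theorem 3 and §6.1 Corollary of Theorem 2 (pp. 41–43)]
[cite: Pohlmann1968, Thm. 1] [cite: Milne1999LefschetzClasses, Thm. 3.2 and Cor. 4.5] [cite: MumfordAV1970, §19 Thm. 1 and p. 169] -/
theorem exists_faceSet_cyclotomic_twentyFour (K : CMField) [IsCyclotomicExtension {24} ℚ (K : Type)] (σ₀ : (K : Type) →+* ℂ) :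
    ∃ 𝒮 : Finset (Face K), 𝒮.card ≤ 3 ∧
      ((∀ f ∈ 𝒮, ∃ ι₁ : K →+* ℂ, f.Admissible ι₁ ∧ ∃ (V : HermSpace3 K ι₁) (σ : K →+* ℂ),
        (Model.picardCMUniverse exists_isReal_hodgeModel_holds hodgePQ_independent_of_hodgeModel_holds
          BallQuotient.ballQuotientUniformised_holds cmAbelianVarietyRealised_holds).PeriodNV ι₁ V K f.psi σ) →
      ∀ {P B : AbelianVariety ℂ}, AbelianVariety.IsProductOf (fun B : AbelianVariety ℂ =>
        ∃ (E : Type) (_ : Field E) (_ : NumberField E) (_ : IsCMField E) (_ : E →+* (K : Type)) (Φ : CMType E)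
          (ι : 𝓞 E →+* End B) (θ : E →+* Module.End ℂ (complexBetti B.X 1)),
          IsCMTypeRealisation Φ B ι θ) P →
      AVDominatedBy B P → HodgeConjectureFor B.dim B.X) := by
  haveI : IsGalois ℚ (K : Type) := IsCyclotomicExtension.isGalois {24} ℚ (K : Type)
  obtain ⟨c, ε, hcσ, hε, hεc⟩ := exists_autDatum_cyclotomic_of_unitTable (K : Type) (N := 24) (A := ZMod 2 × ZMod 2) (by decide)
    (fun u : (ZMod 24)ˣ =>
      if (u : ZMod 24).val = 1 ∨ (u : ZMod 24).val = 23 then ((0, 0) : ZMod 2 × ZMod 2) else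
      if (u : ZMod 24).val = 5 ∨ (u : ZMod 24).val = 19 then ((1, 0) : ZMod 2 × ZMod 2) else
      if (u : ZMod 24).val = 7 ∨ (u : ZMod 24).val = 17 then ((0, 1) : ZMod 2 × ZMod 2) else
      ((1, 1) : ZMod 2 × ZMod 2))
    (by decide) (by decide) (by decide) (by decide) σ₀
  exact exists_faceSet_evenSlice_zmod_two_sq K σ₀ ε hε hcσ hεc

/-- **`ℚ(ζ₂₁)` (degree `12`, `Aut ≅ (ℤ/21)ˣ`, `A ≅ ℤ/6`, `7` orbits): at most `6` faces** whose periods give HC of the slice — no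
datum hypothesis (`3, 7 ∣ 21`, both `≡ 3 (mod 4)`; unit table = cosets `2^k·{±1} ↦ k`).  CONDITIONAL; `HC_CM` is NOT proved.
[cite: Washington1997, Thm. 2.5] [cite: Shimura1998, §6.2 Theorem 3 and §6.1 Corollary of Theorem 2 (pp. 41–43)]
[cite: Pohlmann1968, Thm. 1] [cite: Milne1999LefschetzClasses, Thm. 3.2 and Cor. 4.5] [cite: MumfordAV1970, §19 Thm. 1 and p. 169] -/
theorem exists_faceSet_cyclotomic_twentyOne (K : CMField) [IsCyclotomicExtension {21} ℚ (K : Type)] (σ₀ : (K : Type) →+* ℂ) :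
    ∃ 𝒮 : Finset (Face K), 𝒮.card ≤ 6 ∧
      ((∀ f ∈ 𝒮, ∃ ι₁ : K →+* ℂ, f.Admissible ι₁ ∧ ∃ (V : HermSpace3 K ι₁) (σ : K →+* ℂ),
        (Model.picardCMUniverse exists_isReal_hodgeModel_holds hodgePQ_independent_of_hodgeModel_holds
          BallQuotient.ballQuotientUniformised_holds cmAbelianVarietyRealised_holds).PeriodNV ι₁ V K f.psi σ) →
      ∀ {P B : AbelianVariety ℂ}, AbelianVariety.IsProductOf (fun B : AbelianVariety ℂ =>
        ∃ (E : Type) (_ : Field E) (_ : NumberField E) (_ : IsCMField E) (_ : E →+* (K : Type)) (Φ : CMType E)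
          (ι : 𝓞 E →+* End B) (θ : E →+* Module.End ℂ (complexBetti B.X 1)),
          IsCMTypeRealisation Φ B ι θ) P →
      AVDominatedBy B P → HodgeConjectureFor B.dim B.X) := by
  haveI : IsGalois ℚ (K : Type) := IsCyclotomicExtension.isGalois {21} ℚ (K : Type)
  obtain ⟨c, ε, hcσ, hε, hεc⟩ := exists_autDatum_cyclotomic_of_unitTable (K : Type) (N := 21) (A := ZMod 6) (by decide)
    (fun u : (ZMod 21)ˣ =>
      if (u : ZMod 21).val = 1 ∨ (u : ZMod 21).val = 20 then (0 : ZMod 6) else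
      if (u : ZMod 21).val = 2 ∨ (u : ZMod 21).val = 19 then (1 : ZMod 6) else
      if (u : ZMod 21).val = 4 ∨ (u : ZMod 21).val = 17 then (2 : ZMod 6) else
      if (u : ZMod 21).val = 8 ∨ (u : ZMod 21).val = 13 then (3 : ZMod 6) else
      if (u : ZMod 21).val = 16 ∨ (u : ZMod 21).val = 5 then (4 : ZMod 6) else
      (5 : ZMod 6))
    (by decide) (by decide) (by decide) (by decide) σ₀
  exact exists_faceSet_evenSlice_zmod_six K σ₀ ε hε hcσ hεc

/-- **`ℚ(ζ₂₈)` (degree `12`, `Aut ≅ (ℤ/28)ˣ`, `A ≅ ℤ/6`, `7` orbits): at most `6` faces** whose periods give HC of the slice — no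
datum hypothesis (`4 ∣ 28` (and `7 ≡ 3 (mod 4)`); unit table = cosets `5^k·{±1} ↦ k`).  CONDITIONAL; `HC_CM` is NOT proved.
[cite: Washington1997, Thm. 2.5] [cite: Shimura1998, §6.2 Theorem 3 and §6.1 Corollary of Theorem 2 (pp. 41–43)]
[cite: Pohlmann1968, Thm. 1] [cite: Milne1999LefschetzClasses, Thm. 3.2 and Cor. 4.5] [cite: MumfordAV1970, §19 Thm. 1 and p. 169] -/
theorem exists_faceSet_cyclotomic_twentyEight (K : CMField) [IsCyclotomicExtension {28} ℚ (K : Type)] (σ₀ : (K : Type) →+* ℂ) :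
    ∃ 𝒮 : Finset (Face K), 𝒮.card ≤ 6 ∧
      ((∀ f ∈ 𝒮, ∃ ι₁ : K →+* ℂ, f.Admissible ι₁ ∧ ∃ (V : HermSpace3 K ι₁) (σ : K →+* ℂ),
        (Model.picardCMUniverse exists_isReal_hodgeModel_holds hodgePQ_independent_of_hodgeModel_holds
          BallQuotient.ballQuotientUniformised_holds cmAbelianVarietyRealised_holds).PeriodNV ι₁ V K f.psi σ) →
      ∀ {P B : AbelianVariety ℂ}, AbelianVariety.IsProductOf (fun B : AbelianVariety ℂ =>
        ∃ (E : Type) (_ : Field E) (_ : NumberField E) (_ : IsCMField E) (_ : E →+* (K : Type)) (Φ : CMType E)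
          (ι : 𝓞 E →+* End B) (θ : E →+* Module.End ℂ (complexBetti B.X 1)),
          IsCMTypeRealisation Φ B ι θ) P →
      AVDominatedBy B P → HodgeConjectureFor B.dim B.X) := by
  haveI : IsGalois ℚ (K : Type) := IsCyclotomicExtension.isGalois {28} ℚ (K : Type)
  obtain ⟨c, ε, hcσ, hε, hεc⟩ := exists_autDatum_cyclotomic_of_unitTable (K : Type) (N := 28) (A := ZMod 6) (by decide)
    (fun u : (ZMod 28)ˣ =>
      if (u : ZMod 28).val = 1 ∨ (u : ZMod 28).val = 27 then (0 : ZMod 6) else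
      if (u : ZMod 28).val = 5 ∨ (u : ZMod 28).val = 23 then (1 : ZMod 6) else
      if (u : ZMod 28).val = 25 ∨ (u : ZMod 28).val = 3 then (2 : ZMod 6) else
      if (u : ZMod 28).val = 13 ∨ (u : ZMod 28).val = 15 then (3 : ZMod 6) else
      if (u : ZMod 28).val = 9 ∨ (u : ZMod 28).val = 19 then (4 : ZMod 6) else
      (5 : ZMod 6))
    (by decide) (by decide) (by decide) (by decide) σ₀
  exact exists_faceSet_evenSlice_zmod_six K σ₀ ε hε hcσ hεc

end Summit.HodgeConjecture.CorCM.FaceAbelian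

end
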